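import Summits.QuantumFields.YangMills.Theorems.BalabanUVNodesN26AtBetaC
import Summits.QuantumFields.YangMills.Theorems.BalabanUVNodesN26AtRecord9
import Literature.MathematicalPhysics.QuantumFieldTheory.Balaban1983to89.Node00.Record11

/-!
# DAG node N26 — B4 «β-continuity» AT NODE 00's STAGE-11 RECORD `Node00.IsRecordOfRecord₁₁C` (def-T's `Node00/Record11.lean`, p444286):
# the node's literal at the β OF RECORD AT STAGE 11, `(datumOfRecord₁₁ F N θ h).βfun = betaOfRecord₁₀ θ' = betaOfRecord₉c θ'`
# (`θ' := θ.toStage9Params`) — the VERSION-FREE β over the continuous-version transport `TcOfRecord` and def-χ's fixed-threshold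
# `chiFixed7` — from the (D4) socket BY NAME, the route supply's `YMDAG.UVSplit.N26_B4lit` at `Rec := IsRecordOfRecord₁₁C`, the
# refinement from Stage 10, and «N26 closes WITH N25» at the Stage-11 record

Cell `pub-ymgap`, YM-PLAN Track A (HUMAN RULING D-0062), seat `pub-ymgap-dag-n26-c` (R134 fan-out, strategy s2 = BY-NAME KNIT at the ₁₁
record); fourteenth N26 companion (after dag-n26-a's thirteen `BalabanUVNodesN26*` modules).  STATUS OF RECORD: N26 = binder B4 is DEPENDENT
on (D4) and VACATED in the discharge form of record (closes WITH B3 = N25, NODE O); the (D4)-chain instance for Bałaban's objects is 0∕1.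

WHAT STAGE 11 IS FOR N26.  `Record11` pins the §2 [III] format predicates; its β-functions of record ARE Stage 10's re-pointed β:
`(datumOfRecord₁₁ F N θ h).βfun = betaOfRecord₁₀ F N θ.toStage9Params` (`Node00.βfun_datumOfRecord₁₁`, `rfl`) `= betaOfRecord₉c θ'` (`abbrev`)
`= betaOfRecord₈T (TcOfRecord) θ'.toStage8Params` (`Node00.betaOfRecord₉c_eq`) — [I] (1.20)–(1.22) on def-B's transport-generic merged term family
`mergedTermFamilyMatT F N (TcOfRecord F N) (chiFixed7 F N θ.ν) θ.εbg`: every input `A_{k+1}` read through the CONTINUOUS-VERSION transport `TcOfRecord`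
(point values determined, `Node00.TcOfRecord_eq_of_continuous`) and def-χ's flow-blind fixed-threshold χ (`Node00.chiFixed7_flowBlind`).  So RIDER OF
RECORD №6 (β-VERSION; director-ym LINE №44∕№45 (2)) — under which NO β-side binder was bookable over `betaOfRecord₈∕₉` — is MET BY THE RECORD at
Stage 11: the record predicate CONJOINS the β-version proviso `θ.toStage8Params.HasContTransportAlong` (`Node00.Stage11Params.Provisos₁₁.hasContTransportAlong`,
dag-ref-D (C1); faces `Node00.betaInput_ae_eq_and_continuous₁₁`, `Node00.exists_betaVersion_of_isRecordOfRecord₁₁C`), so the (D4) socket inputs below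
are statements about DETERMINED objects of the record.  Every run's flow at Stage 11 is `genFlow (betaOfRecord₁₀ θ') p.g0` — the Stage-10 datum's
— so N25's END face transports ₁₁ ↔ ₁₀ (NOT ↔ ₈∕₉: the β re-point changed the flows).
* §0 bridges: `βfun_datumOfRecord₁₁_eq_betaOfRecord₉c`, `βfun_datumOfRecord₁₁_eq_stage10`, `flow_toB12_datumOfRecord₁₁_eq_stage10`,
  `endpointExistence_datumOfRecord₁₁_iff_stage10`, `betaContH_datumOfRecord₁₁_iff_stage10`, `betaContH_datumOfRecord₁₁_iff` (what B4 IS at the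
  ₁₁ datum: per-`k` history-continuity of the merged β over `(TcOfRecord, chiFixed7 θ.ν)` on the box, `γc ≤ θ.γ`).
* §1 `n26_datumOfRecord₁₁` — N26's literal at the ₁₁ datum from the (D4) socket inputs FOR θ's OWN `(TcOfRecord, chiFixed7 θ.ν)` merged family
  (dag-n26-a's `BalabanUVNodesN26AtBetaC.n26lit_betaOfRecord₉c_of_localizedRep` BY NAME at `θ.toStage9Params`); `n26_of_isRecordOfRecord₁₁C` — the
  record-PREDICATE form (box = the world's window `]0, w.γ]`, a clause of the predicate; the chart clause of record is inside Stage-9 admissibility);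
  `n26_datumOfRecord₁₁_of_chainTFac190H` — the (D4)-CHAIN FOLD at the ₁₁ datum verbatim (director-ym R134 row): ANY split of the datum's β + ONE
  `ChainTFac190H` inhabitant with (C-pt) and the side conditions on a box `0 < γ₀`.
* §2 `n26_B4lit_rec11C` — THE ∀-FORM OF RECORD at Stage 11: `N26_B4lit (IsRecordOfRecord₁₁C …)` from §1's inputs asked of every admissible θ with provisos.
* §3 the refinement from Stage 10: `exists_rec10C_βfun_eq_of_isRecordOfRecord₁₁C` (every ₁₁C record has a Stage-10 record — `θ.toStage9Params` under
  `h.base` at a FRESH world, `Node00.exists_world_isRecordOfRecord₁₀C` — with the same `βfun` and window; NOT at the ₁₁ world: `IsRecordOfRecord₁₁C ↛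
  IsRecordOfRecord₁₀C` at the datum, `Record11` header), `n26_B4lit_rec11C_of_rec10C` (₁₁C closers ≤ ₁₀C closers).
* §4 «N26 closes WITH N25» at Stage 11: `endpoint_and_n26_datumOfRecord₁₁` (row (D1)'s residue pinned on the record's one-loop object
  `beta0OfMerged … θ.v₀` + the socket inputs ⇒ `EndpointExistence D.C.toB12 ∧ ∃ γc > 0, BetaContH γc D.βfun`; forward generation = the datum's
  field `fwd`, the split = `Node00.oneLoopSplit_betaOfMerged`; `Gaps.BetaContFromD4Chain.endpointExistence_of_residue_atSlopeCont` ∘ dag-n26-a's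
  `BalabanUVNodesN26Merged.atSlopeCont_betaOfMerged`), the predicate form `endpoint_and_n26_of_isRecordOfRecord₁₁C` (ONE pin, channel `(0, 1)`), and
  `s_N25_and_n26_B4lit_rec11C` (the route literals `YMDAG.UVSplit.S_N25 ∧ YMDAG.UVSplit.N26_B4lit` at `Rec := IsRecordOfRecord₁₁C` from ONE (D1)+(D4)
  input package per admissible θ — the β-side shape route crux K2 `EndpointGivenBR11` quantifies over, its (B) and window hypotheses unused).

HONEST FRAMING.  Count-neutral bookkeeping by name for a VACATED binder; no definition, no estimate, 0 `sorry`.  Every socket input (`P0 ∕ hβ0 ∕ hP0 ∕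
A1 ∕ hrep ∕ hleaves ∕ (C-pt)`, the side conditions, the (D1) residue and pin) is a located hypothesis of NODE O ∕ row (D1) about the record's OWN merged
term family — INSTANCE 0∕1 (the objects-side half `B13Core214EntryHolomorphic` p435418 gives no `ChainTFac190H` inhabitant); the zero-activity witness
(`RemainderWitness.zeroChain190` ∕ `splitZero`) is the WRONG β and is NOT used anywhere below.  `IsRecordOfRecord₁₁C` is not junk-inhabited (K0
`Record11Inhabited` is analytic: the displayed provisos incl. `contT`), so the ∀-forms are NOT-A-DISCHARGE (INHABITED-AT-₁₁C guard); N25 ∕ N26 NOT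
discharged; nothing of Bałaban's β asserted.  One finite four-torus programme at fixed ε per run — NOT the continuum limit, NOT ℝ⁴, NOT infinite
volume, NOT OS, NOT a mass gap, NOT Clay.
Sources (context): [I] = [Balaban1987RG1] CMP **109** (1987): Thm 2 p. 259, (0.13) p. 254, (0.17)–(0.20) pp. 255–256, (1.7) p. 261, (2.9) p. 259,
(1.20)–(1.22) p. 264, (2.12)–(2.13) p. 268, (5.10) p. 293; [II] = [Balaban1988RG2Cluster] CMP **116** (1988): Lemma 3 (2.38) p. 20; [III] =
[Balaban1988Convergent] CMP **119** (1988): (2.18) p. 257; [Balaban1989LargeFieldII] CMP **122** (1989): Thm 1 p. 355.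
-/

noncomputable section

open scoped Matrix.Norms.L2Operator

namespace Summit.QuantumFields.YangMills.Theorems.BalabanUVNodesN26AtRecord11

open Literature.MathematicalPhysics.QuantumFieldTheory.Balaban1983to89
open Literature.MathematicalPhysics.QuantumFieldTheory.Balaban1983to89.FlowStep
open Literature.MathematicalPhysics.QuantumFieldTheory.Balaban1983to89.DagBinding (EndpointExistence WorldP)
open Literature.MathematicalPhysics.QuantumFieldTheory.Balaban1983to89.T4Continuum (T4Family FiniteEpsData)
open Literature.MathematicalPhysics.QuantumFieldTheory.Balaban1983to89.Node00
open Literature.MathematicalPhysics.QuantumFieldTheory.Balaban1983to89.B13ScaleTransfer (Pt)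
open Literature.MathematicalPhysics.QuantumFieldTheory.Balaban1983to89.Beta.RemainderChainLattice
open Literature.MathematicalPhysics.QuantumFieldTheory.Balaban1983to89.Beta.RemainderLimitTorus (LDom limKernel)
open Literature.MathematicalPhysics.QuantumFieldTheory.Balaban1983to89.Beta.RemainderDecay190
open Literature.MathematicalPhysics.QuantumFieldTheory.Balaban1983to89.Beta.RemainderLocalityHolo (PolLeavesTFac190H)
open Literature.MathematicalPhysics.QuantumFieldTheory.Balaban1983to89.Beta.RemainderDecay190HoloChain (ChainTFac190H)
open Literature.MathematicalPhysics.QuantumFieldTheory.Balaban1983to89.Beta.OneStepKernelFamily (TbalOf)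
open Literature.MathematicalPhysics.QuantumFieldTheory.Balaban1983to89.Beta.OneStepResolventKernel (JetData)
open Summit.QuantumFields.BalabanUV.Gaps
open Summit.QuantumFields.BalabanUV.Gaps.BetaContFromD4Chain
open Summit.QuantumFields.YangMills.Theorems.BalabanUVNodesN26Merged (atSlopeCont_betaOfMerged)
open Summit.QuantumFields.YangMills.Theorems.BalabanUVNodesN26AtBetaC (betaContH_betaOfRecord₉c_iff n26lit_betaOfRecord₉c_of_localizedRep)
open Summit.QuantumFields.YangMills.Theorems.BalabanUVNodesN26AtRecord9 (endpointExistence_congr n26_B4lit_of_betaShadow)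
open Filter Topology

/-! ## §0 Bridges: the Stage-11 datum has the Stage-10 datum's β-functions and flows; what B4 IS at the ₁₁ datum -/

section Bridges

variable (F : T4Family) (N : ℕ) [NeZero N]

/-- **THE β OF RECORD AT STAGE 11 IS `betaOfRecord₉c`** of the Stage-9 part: `(datumOfRecord₁₁ F N θ h).βfun = betaOfRecord₉c F N θ.toStage9Params`
(`Node00.βfun_datumOfRecord₁₁` and the `abbrev` `betaOfRecord₁₀ := betaOfRecord₉c`; `rfl`) — the VERSION-FREE β over the continuous-version transport
`TcOfRecord` and the fixed-threshold `chiFixed7` (RIDER №6's repair of record, certified at this record by `Provisos₁₁.hasContTransportAlong`).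
[cite: Balaban1987RG1, (0.13) p.254 and (1.20)-(1.22) p.264 (bookkeeping)] -/
theorem βfun_datumOfRecord₁₁_eq_betaOfRecord₉c (θ : Stage11Params F N) (h : θ.Provisos₁₁) :
    (datumOfRecord₁₁ F N θ h).βfun = betaOfRecord₉c F N θ.toStage9Params := rfl

/-- **… and IS the Stage-10 datum's β** of `θ.toStage9Params` under the inherited provisos `h.base` (`rfl`). [cite: Balaban1987RG1, (1.20)-(1.22) p.264 (bookkeeping)] -/
theorem βfun_datumOfRecord₁₁_eq_stage10 (θ : Stage11Params F N) (h : θ.Provisos₁₁) :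
    (datumOfRecord₁₁ F N θ h).βfun = (datumOfRecord₁₀ F N θ.toStage9Params h.base).βfun := rfl

/-- **The Stage-11 datum's runs have THE SAME FLOWS as the Stage-10 datum's of `θ.toStage9Params`**: both are `genFlow (betaOfRecord₁₀ F N θ.toStage9Params)`
from the bare coupling (the Stage-11 core IS the Stage-10 core with the §2 clause pinned; `Node00.flow_datumOfRecord₁₀`). [cite: Balaban1987RG1, (0.17)-(0.20) pp.255-256 (bookkeeping)] -/
theorem flow_toB12_datumOfRecord₁₁_eq_stage10 (θ : Stage11Params F N) (h : θ.Provisos₁₁) (P : B12.RunParams) :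
    ((datumOfRecord₁₁ F N θ h).C.toB12 P).flow = ((datumOfRecord₁₀ F N θ.toStage9Params h.base).C.toB12 P).flow := by
  show ((datumOfRecord₁₁ F N θ h).C P).flow = ((datumOfRecord₁₀ F N θ.toStage9Params h.base).C P).flow
  rw [flow_datumOfRecord₁₀]
  rfl

/-- **N25's END AT THE STAGE-11 DATUM ↔ AT THE STAGE-10 DATUM of `θ.toStage9Params`** (same flows; dag-n26-a's `endpointExistence_congr` BY NAME).  NOT ↔
the Stage-8∕9 datum: there the flows are `genFlow (betaOfRecord₈ …)`, a different β. [cite: Balaban1987RG1, Thm 2 p.259 (first sentence; bookkeeping)] -/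
theorem endpointExistence_datumOfRecord₁₁_iff_stage10 (θ : Stage11Params F N) (h : θ.Provisos₁₁) :
    EndpointExistence (datumOfRecord₁₁ F N θ h).C.toB12 ↔
      EndpointExistence (datumOfRecord₁₀ F N θ.toStage9Params h.base).C.toB12 :=
  endpointExistence_congr (flow_toB12_datumOfRecord₁₁_eq_stage10 F N θ h)

/-- **B4 on a box `γc` AT THE STAGE-11 DATUM ↔ AT THE STAGE-10 DATUM of `θ.toStage9Params`** (same `βfun`). [cite: Balaban1987RG1, (1.20)-(1.22) p.264 (bookkeeping)] -/
theorem betaContH_datumOfRecord₁₁_iff_stage10 (θ : Stage11Params F N) (h : θ.Provisos₁₁) (γc : ℝ) :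
    BetaContH γc (datumOfRecord₁₁ F N θ h).βfun ↔ BetaContH γc (datumOfRecord₁₀ F N θ.toStage9Params h.base).βfun :=
  Iff.rfl

/-- **WHAT B4 IS AT THE STAGE-11 DATUM OF RECORD**: on a box `γc ≤ θ.γ`, `BetaContH γc (datumOfRecord₁₁ F N θ h).βfun` IS per-`k` history-continuity on
`]0, γc]^{k+1}` of the MERGED β `betaMerged F (mergedTermFamilyMatT F N (TcOfRecord F N) (chiFixed7 F N θ.ν) θ.εbg) θ.ρ8 θ.bV k` — [I] (1.20)–(1.22) on
the merged term (1.6) over the continuous-version transport and the fixed-threshold χ (dag-n26-a's `BalabanUVNodesN26AtBetaC.betaContH_betaOfRecord₉c_iff`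
BY NAME); DETERMINED point values at this record (`Provisos₁₁.hasContTransportAlong`; dag-ref-D (C1)–(C3)). [cite: Balaban1987RG1, (0.13) p.254 and (1.20)-(1.22) p.264] -/
theorem betaContH_datumOfRecord₁₁_iff (θ : Stage11Params F N) (h : θ.Provisos₁₁) {γc : ℝ} (hle : γc ≤ θ.γ) :
    BetaContH γc (datumOfRecord₁₁ F N θ h).βfun ↔
      letI := θ.instVβ₁; letI := θ.instVβ₂; letI := θ.instιβ
      ∀ k, ContinuousOn
        (betaMerged F (mergedTermFamilyMatT F N (TcOfRecord F N) (chiFixed7 F N θ.ν) θ.εbg) θ.ρ8 θ.bV k) (Box γc k) :=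
  betaContH_betaOfRecord₉c_iff F N θ.toStage9Params hle

end Bridges

/-! ## §1 N26 at the Stage-11 datum and at a Stage-11 record, from the (D4) socket inputs; the (D4)-chain fold at the datum -/

section AtRecord

variable (F : T4Family) (N : ℕ) [NeZero N]

/-- **N26 AT THE STAGE-11 DATUM OF RECORD** `datumOfRecord₁₁ F N θ hP` from the (D4) socket inputs FOR θ's OWN merged term family over the continuous-version
transport and the fixed-threshold χ, `mergedTermFamilyMatT F N (TcOfRecord F N) (chiFixed7 F N θ.ν) θ.εbg` (chart `θ.ρ8 ∕ θ.bV`, one-loop object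
`beta0OfMerged … θ.v₀`), on a box `0 < γ₀ ≤ θ.γ`: `hβ0` (the one-loop object IS the second moment of a coupling-free kernel `P0 k`), `hP0` ((5.10)),
the leaf kernels `A1`, `hrep` (the merged LIMIT kernel (1.21) splits on the box as `P0 + Σ'_Y A1`, [I] (2.12)–(2.13) with (1.7)), `hleaves`
([II]-(2.38)∕(190) records), the side conditions, (C-pt) ⟹ `∃ γc > 0, BetaContH γc D.βfun` — dag-n26-a's `n26lit_betaOfRecord₉c_of_localizedRep` at
`θ.toStage9Params`.  Every input a located hypothesis of NODE O about DETERMINED objects of the record (RIDER №6 met at ₁₁); instance 0∕1; N26 NOT discharged.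
[cite: Balaban1987RG1, (0.13) p.254, (1.7) p.261, (2.9) p.259, (1.20)-(1.22) p.264 and (5.10) p.293; Balaban1988RG2Cluster, Lemma 3 (2.38) p.20] -/
theorem n26_datumOfRecord₁₁ (θ : Stage11Params F N) (hP : θ.Provisos₁₁) {γ₀ : ℝ} (hγ₀ : 0 < γ₀) (hle : γ₀ ≤ θ.γ) {M : ℕ} [NeZero M]
    {c : B13.Consts} {ℓ α₂ : ℝ} {q : Consts190} (P0 : ℕ → Pt 4 → ℝ)
    (hβ0 : letI := θ.instVβ₁; letI := θ.instVβ₂; letI := θ.instιβ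
      ∀ k, beta0OfMerged (betaMerged F (mergedTermFamilyMatT F N (TcOfRecord F N) (chiFixed7 F N θ.ν) θ.εbg) θ.ρ8 θ.bV) θ.v₀ k =
        B12Beta.secondMoment (fun _ _ => P0 k) 0 1)
    (hP0 : ∀ k, ∃ C δ₁ : ℝ, 0 < δ₁ ∧ B12Sec2to5.Decay510 (P0 k) C δ₁)
    (A1 : (k : ℕ) → (Fin (k + 1) → ℝ) → LDom 4 → Pt 4 → ℝ)
    (hrep : letI := θ.instVβ₁; letI := θ.instVβ₂; letI := θ.instιβ
      ∀ k (p : Fin (k + 1) → ℝ), p ∈ Box γ₀ k → ∀ z : Pt 4,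
        polLimit F (k + 1) (fun K => mergedTermFamilyMatT F N (TcOfRecord F N) (chiFixed7 F N θ.ν) θ.εbg k p K) θ.ρ8 θ.bV 0 1 z =
          P0 k z + limKernel (A1 k p) z)
    (hleaves : ∀ k (p : Fin (k + 1) → ℝ), p ∈ Box γ₀ k → PolLeavesTFac190H 4 M (A1 k p) c ℓ α₂ q)
    (hC : CondsL 4 c ℓ) (h22 : c.R22gen ℓ) (hq : q.Valid c.δ₀) (hs : SignsL c α₂ q.B₃)
    (hcont : letI := θ.instVβ₁; letI := θ.instVβ₂; letI := θ.instιβ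
      ∀ k (z : Pt 4), ContinuousOn (fun p : Fin (k + 1) → ℝ =>
        polLimit F (k + 1) (fun K => mergedTermFamilyMatT F N (TcOfRecord F N) (chiFixed7 F N θ.ν) θ.εbg k p K) θ.ρ8 θ.bV 0 1 z)
        (Box γ₀ k)) :
    ∃ γc : ℝ, 0 < γc ∧ BetaContH γc (datumOfRecord₁₁ F N θ hP).βfun := by
  rw [βfun_datumOfRecord₁₁_eq_betaOfRecord₉c]
  exact n26lit_betaOfRecord₉c_of_localizedRep F N θ.toStage9Params hγ₀ hle P0 hβ0 hP0 A1 hrep hleaves hC h22 hq hs hcont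

/-- **N26 AT A STAGE-11 RECORD `(D, w)`** (`Node00.IsRecordOfRecord₁₁C F N D w`, predicate form): the box is the binding world's own small-coupling window
`]0, w.γ]` — `0 < w.γ ∧ w.γ ≤ θ.γ` is a CLAUSE OF THE RECORD PREDICATE, so neither `0 < γ₀` nor the cap is an extra hypothesis — and the socket inputs
are asked of EVERY admissible θ (WITH PROVISOS) whose Stage-11 datum is `D`; Stage-11 admissibility carries the Stage-9 chart clause of record
(`Stage9Params.Admissible.chart`; chair R445 (A)(a2)).  Every input a located hypothesis of NODE O; instance 0∕1; N26 NOT discharged.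
[cite: Balaban1987RG1, (0.13) p.254 and (1.20)-(1.22) p.264; Balaban1988RG2Cluster, Lemma 3 (2.38) p.20] -/
theorem n26_of_isRecordOfRecord₁₁C {D : FiniteEpsData F (Matrix.specialUnitaryGroup (Fin N) ℂ)} {w : WorldP}
    (h : IsRecordOfRecord₁₁C F N D w)
    (hin : ∀ (θ : Stage11Params F N) (hP : θ.Provisos₁₁), θ.Admissible → D = datumOfRecord₁₁ F N θ hP → w.γ ≤ θ.γ →
      letI := θ.instVβ₁; letI := θ.instVβ₂; letI := θ.instιβ
      ∃ (M : ℕ) (_ : NeZero M) (c : B13.Consts) (ℓ α₂ : ℝ) (q : Consts190) (P0 : ℕ → Pt 4 → ℝ)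
        (A1 : (k : ℕ) → (Fin (k + 1) → ℝ) → LDom 4 → Pt 4 → ℝ),
        (∀ k, beta0OfMerged (betaMerged F (mergedTermFamilyMatT F N (TcOfRecord F N) (chiFixed7 F N θ.ν) θ.εbg) θ.ρ8 θ.bV) θ.v₀ k =
          B12Beta.secondMoment (fun _ _ => P0 k) 0 1) ∧
        (∀ k, ∃ C δ₁ : ℝ, 0 < δ₁ ∧ B12Sec2to5.Decay510 (P0 k) C δ₁) ∧
        (∀ k (p : Fin (k + 1) → ℝ), p ∈ Box w.γ k → ∀ z : Pt 4,
          polLimit F (k + 1) (fun K => mergedTermFamilyMatT F N (TcOfRecord F N) (chiFixed7 F N θ.ν) θ.εbg k p K) θ.ρ8 θ.bV 0 1 z =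
            P0 k z + limKernel (A1 k p) z) ∧
        (∀ k (p : Fin (k + 1) → ℝ), p ∈ Box w.γ k → Nonempty (PolLeavesTFac190H 4 M (A1 k p) c ℓ α₂ q)) ∧
        CondsL 4 c ℓ ∧ c.R22gen ℓ ∧ q.Valid c.δ₀ ∧ SignsL c α₂ q.B₃ ∧
        (∀ k (z : Pt 4), ContinuousOn (fun p : Fin (k + 1) → ℝ =>
          polLimit F (k + 1) (fun K => mergedTermFamilyMatT F N (TcOfRecord F N) (chiFixed7 F N θ.ν) θ.εbg k p K) θ.ρ8 θ.bV 0 1 z)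
          (Box w.γ k))) :
    ∃ γc : ℝ, 0 < γc ∧ BetaContH γc D.βfun := by
  obtain ⟨θ, hP, hθ, hD, -, ⟨hγ0, hγle⟩, -, -⟩ := h
  obtain ⟨M, _, c, ℓ, α₂, q, P0, A1, hβ0, hP0, hrep, hleaves, hC, h22, hq, hs, hcont⟩ := hin θ hP hθ hD hγle
  subst hD
  exact n26_datumOfRecord₁₁ F N θ hP hγ0 hγle P0 hβ0 hP0 A1 hrep (fun k p hp => Classical.choice (hleaves k p hp)) hC h22 hq hs
    hcont

/-- **THE (D4)-CHAIN FOLD AT THE STAGE-11 DATUM OF RECORD, VERBATIM** (director-ym R134 row for this seat: «the (D4)-chain INSTANCE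
`Gaps.BetaContFromD4Chain.betaContH_of_chainTFac190H` for the datum of record at the ₁₁ β»): for ANY one-loop split `Sβ` of `(datumOfRecord₁₁ F N θ hP).βfun`
(the split of a `betaOfMerged` β is unique, dag-n28-a's `N28AtBetaOfRecord.oneLoopSplit_unique`; not used), ONE inhabitant `R : ChainTFac190H 4 M μ ν Sβ γ₀ c ℓ α₂ q`
of the row-(D4) chain (localized-holomorphic leaf kernels `R.A1` whose second moments ARE `Sβ.β1` on the box, with [II]-(2.38)∕(190) leaves), the side
conditions, the ONE clause (C-pt) `CPt R` and `0 < γ₀` ⟹ N26's literal with `γc := γ₀`.  THIS is the object NODE O owes for Bałaban's construction —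
instance 0∕1 (the objects-side half `B13Core214EntryHolomorphic.core214_jet_agreement` is landed; no inhabitant); §1's `n26_datumOfRecord₁₁` is the same
fold with `R` BUILT from the socket inputs (`BalabanUVNodesN26Merged.atSlopeCont_betaOfMerged`).  The zero-activity chain `RemainderWitness.zeroChain190`
inhabits `ChainTFac190H` only for the FLAT split `splitZero` of `β ≡ 0` — the WRONG β; not used.
[cite: Balaban1987RG1, (1.7) p.261, (1.20)-(1.22) p.264 and (5.10) p.293; Balaban1988RG2Cluster, Lemma 3 (2.38) p.20] -/
theorem n26_datumOfRecord₁₁_of_chainTFac190H (θ : Stage11Params F N) (hP : θ.Provisos₁₁) {M : ℕ} [NeZero M] {μ ν : Fin 4}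
    (Sβ : B12Beta.OneLoopSplit (datumOfRecord₁₁ F N θ hP).βfun) {γ₀ : ℝ} (hγ₀ : 0 < γ₀) {c : B13.Consts} {ℓ α₂ : ℝ} {q : Consts190}
    (R : ChainTFac190H 4 M μ ν Sβ γ₀ c ℓ α₂ q) (hC : CondsL 4 c ℓ) (h22 : c.R22gen ℓ) (hq : q.Valid c.δ₀) (hs : SignsL c α₂ q.B₃)
    (hcont : CPt R) : ∃ γc : ℝ, 0 < γc ∧ BetaContH γc (datumOfRecord₁₁ F N θ hP).βfun :=
  ⟨γ₀, hγ₀, betaContH_of_chainTFac190H R hC h22 hq hs (by norm_num) hcont⟩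

end AtRecord

/-! ## §2 The route supply's `N26_B4lit` at `Rec := IsRecordOfRecord₁₁C` — the ∀-form of record at Stage 11 -/

section Route

variable {N : ℕ} [NeZero N]

/-- **`N26_B4lit` AT THE STAGE-11 RECORD PREDICATE — THE ∀-FORM OF RECORD** (every F, every record pair, EVERY admissible θ with provisos realising the
datum; the chart of record and the β-version proviso are part of admissibility ∕ the provisos), from the (D4) socket inputs for θ's own
`(TcOfRecord, chiFixed7 θ.ν)` merged term family (§1).  RIDER №6 MET at this record (`Provisos₁₁.hasContTransportAlong`).  Instance 0∕1; NOT-A-DISCHARGE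
(INHABITED-AT-₁₁C guard, K0 `Record11Inhabited`); N26 NOT discharged. [cite: Balaban1987RG1, (0.13) p.254, (1.7) p.261 and (1.20)-(1.22) p.264; Balaban1988RG2Cluster, Lemma 3 (2.38) p.20] -/
theorem n26_B4lit_rec11C
    (hin : ∀ (F : T4Family) (D : FiniteEpsData F (Matrix.specialUnitaryGroup (Fin N) ℂ)) (w : WorldP)
      (θ : Stage11Params F N) (hP : θ.Provisos₁₁), θ.Admissible → D = datumOfRecord₁₁ F N θ hP → w.γ ≤ θ.γ →
      letI := θ.instVβ₁; letI := θ.instVβ₂; letI := θ.instιβ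
      ∃ (M : ℕ) (_ : NeZero M) (c : B13.Consts) (ℓ α₂ : ℝ) (q : Consts190) (P0 : ℕ → Pt 4 → ℝ)
        (A1 : (k : ℕ) → (Fin (k + 1) → ℝ) → LDom 4 → Pt 4 → ℝ),
        (∀ k, beta0OfMerged (betaMerged F (mergedTermFamilyMatT F N (TcOfRecord F N) (chiFixed7 F N θ.ν) θ.εbg) θ.ρ8 θ.bV) θ.v₀ k =
          B12Beta.secondMoment (fun _ _ => P0 k) 0 1) ∧
        (∀ k, ∃ C δ₁ : ℝ, 0 < δ₁ ∧ B12Sec2to5.Decay510 (P0 k) C δ₁) ∧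
        (∀ k (p : Fin (k + 1) → ℝ), p ∈ Box w.γ k → ∀ z : Pt 4,
          polLimit F (k + 1) (fun K => mergedTermFamilyMatT F N (TcOfRecord F N) (chiFixed7 F N θ.ν) θ.εbg k p K) θ.ρ8 θ.bV 0 1 z =
            P0 k z + limKernel (A1 k p) z) ∧
        (∀ k (p : Fin (k + 1) → ℝ), p ∈ Box w.γ k → Nonempty (PolLeavesTFac190H 4 M (A1 k p) c ℓ α₂ q)) ∧
        CondsL 4 c ℓ ∧ c.R22gen ℓ ∧ q.Valid c.δ₀ ∧ SignsL c α₂ q.B₃ ∧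
        (∀ k (z : Pt 4), ContinuousOn (fun p : Fin (k + 1) → ℝ =>
          polLimit F (k + 1) (fun K => mergedTermFamilyMatT F N (TcOfRecord F N) (chiFixed7 F N θ.ν) θ.εbg k p K) θ.ρ8 θ.bV 0 1 z)
          (Box w.γ k))) :
    YMDAG.UVSplit.N26_B4lit (fun F D w => IsRecordOfRecord₁₁C F N D w) :=
  fun F D w h => n26_of_isRecordOfRecord₁₁C F N h (hin F D w)

end Route

/-! ## §3 The refinement from Stage 10, through a β-shadow at a fresh world -/

section Shadow

variable (F : T4Family) (N : ℕ) [NeZero N]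

/-- **EVERY STAGE-11 RECORD HAS A STAGE-10 RECORD WITH THE SAME β-FUNCTIONS AND THE SAME WINDOW**: for `(D, w)` with ₁₁C witness `θ` (provisos `h`), the
Stage-10 datum of `θ.toStage9Params` under the inherited provisos `h.base` (Stage-9 admissible, `Stage11Params.Admissible.toStage9`) at a FRESH world of
window `w.γ` (`Node00.exists_world_isRecordOfRecord₁₀C`) is a ₁₀C record, and its `βfun` is `D`'s (`βfun_datumOfRecord₁₁_eq_stage10`).  NOT the ₁₁ world
itself: its construction is the Stage-11 core's, `IsRecordOfRecord₁₁C ↛ IsRecordOfRecord₁₀C` at the datum (`Record11` header).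
[cite: Balaban1989LargeFieldII, Thm 1 + (0.1) pp.355-356; Balaban1987RG1, (1.20)-(1.22) p.264 (bookkeeping)] -/
theorem exists_rec10C_βfun_eq_of_isRecordOfRecord₁₁C {D : FiniteEpsData F (Matrix.specialUnitaryGroup (Fin N) ℂ)} {w : WorldP}
    (h : IsRecordOfRecord₁₁C F N D w) :
    ∃ (D' : FiniteEpsData F (Matrix.specialUnitaryGroup (Fin N) ℂ)) (w' : WorldP),
      IsRecordOfRecord₁₀C F N D' w' ∧ D'.βfun = D.βfun ∧ w'.γ = w.γ := by
  obtain ⟨θ, hP, hθ, hD, -, hγ, -, -⟩ := h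
  obtain ⟨w', hw', hγ'⟩ := exists_world_isRecordOfRecord₁₀C F N θ.toStage9Params hP.base hθ.toStage9 hγ
  subst hD
  exact ⟨_, w', hw', (βfun_datumOfRecord₁₁_eq_stage10 F N θ hP).symm, hγ'⟩

variable {F N}

/-- **WHOEVER CLOSES THE STAGE-10 ∀-FORM CLOSES THE STAGE-11 ONE**: `N26_B4lit (IsRecordOfRecord₁₀C …) → N26_B4lit (IsRecordOfRecord₁₁C …)`, by the β-shadow
(`exists_rec10C_βfun_eq_of_isRecordOfRecord₁₁C`, dag-n26-a's `n26_B4lit_of_betaShadow` BY NAME: N26 reads only `βfun`). [cite: Balaban1987RG1, (1.22) p.264 (bookkeeping)] -/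
theorem n26_B4lit_rec11C_of_rec10C (h : YMDAG.UVSplit.N26_B4lit (fun F D w => IsRecordOfRecord₁₀C F N D w)) :
    YMDAG.UVSplit.N26_B4lit (fun F D w => IsRecordOfRecord₁₁C F N D w) :=
  n26_B4lit_of_betaShadow (fun F _ _ hw => by
    obtain ⟨D', w', h', hβ, -⟩ := exists_rec10C_βfun_eq_of_isRecordOfRecord₁₁C F N hw
    exact ⟨D', w', h', hβ⟩) h

end Shadow

/-! ## §4 «N26 closes WITH N25» at Stage 11: END ∧ B4 from one (D1)+(D4) package -/

section WithN25

variable (F : T4Family) (N : ℕ) [NeZero N]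

/-- **N25's END ∧ N26 AT THE STAGE-11 DATUM OF RECORD** — «B4 closes WITH B3» at `D := datumOfRecord₁₁ F N θ hP`: row (D1)'s residue
`Gaps.D1Residue.Residue Lc Js Nc μ ν` with its identification pinned ON THE RECORD's ONE-LOOP OBJECT (`hβ : beta0OfMerged … θ.v₀ j = Σ_z T̄_j(z) z_μ z_ν`),
the socket inputs at the one-loop slope `ε₁·K_rem,L ≤ stepBal Nc Lc`, `0 < γ₀ ≤ θ.γ` ⟹ `EndpointExistence D.C.toB12 ∧ ∃ γc > 0, BetaContH γc D.βfun` —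
forward generation = the datum's field `FiniteEpsData.fwd`, the split = the record's DEFINITIONAL `Node00.oneLoopSplit_betaOfMerged` for the merged β over
`(TcOfRecord, chiFixed7 θ.ν)` (`Gaps.BetaContFromD4Chain.endpointExistence_of_residue_atSlopeCont` ∘ dag-n26-a's `BalabanUVNodesN26Merged.atSlopeCont_betaOfMerged`
BY NAME, then `betaContH_of_atSlopeCont`); the END face is at the Stage-11 = Stage-10 flows.  Instance 0∕1 on rows (D1) and (D4); N25 ∕ N26 NOT discharged.
[cite: Balaban1987RG1, Thm 2 p.259 (first sentence), (0.13) p.254 and (1.20)-(1.22) p.264; Balaban1988RG2Cluster, Lemma 3 (2.38) p.20] -/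
theorem endpoint_and_n26_datumOfRecord₁₁ (θ : Stage11Params F N) (hP : θ.Provisos₁₁) {Lc : ℕ} [NeZero Lc] (Js : ℕ → JetData 3 Lc) {Nc : ℝ}
    {μ ν : Fin 4}
    (hβ : letI := θ.instVβ₁; letI := θ.instVβ₂; letI := θ.instιβ
      ∀ j, beta0OfMerged (betaMerged F (mergedTermFamilyMatT F N (TcOfRecord F N) (chiFixed7 F N θ.ν) θ.εbg) θ.ρ8 θ.bV) θ.v₀ j =
        B12Beta.secondMoment (TbalOf Lc Js j) μ ν)
    (h1 : D1Residue.Residue Lc Js Nc μ ν) {γ₀ : ℝ} (hγ₀ : 0 < γ₀) (hle : γ₀ ≤ θ.γ) {M : ℕ} [NeZero M]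
    {c : B13.Consts} {ℓ α₂ : ℝ} {q : Consts190} (P0 : ℕ → Pt 4 → ℝ)
    (hβ0 : letI := θ.instVβ₁; letI := θ.instVβ₂; letI := θ.instιβ
      ∀ k, beta0OfMerged (betaMerged F (mergedTermFamilyMatT F N (TcOfRecord F N) (chiFixed7 F N θ.ν) θ.εbg) θ.ρ8 θ.bV) θ.v₀ k =
        B12Beta.secondMoment (fun _ _ => P0 k) 0 1)
    (hP0 : ∀ k, ∃ C δ₁ : ℝ, 0 < δ₁ ∧ B12Sec2to5.Decay510 (P0 k) C δ₁)
    (A1 : (k : ℕ) → (Fin (k + 1) → ℝ) → LDom 4 → Pt 4 → ℝ)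
    (hrep : letI := θ.instVβ₁; letI := θ.instVβ₂; letI := θ.instιβ
      ∀ k (p : Fin (k + 1) → ℝ), p ∈ Box γ₀ k → ∀ z : Pt 4,
        polLimit F (k + 1) (fun K => mergedTermFamilyMatT F N (TcOfRecord F N) (chiFixed7 F N θ.ν) θ.εbg k p K) θ.ρ8 θ.bV 0 1 z =
          P0 k z + limKernel (A1 k p) z)
    (hleaves : ∀ k (p : Fin (k + 1) → ℝ), p ∈ Box γ₀ k → PolLeavesTFac190H 4 M (A1 k p) c ℓ α₂ q)
    (hC : CondsL 4 c ℓ) (h22 : c.R22gen ℓ) (hq : q.Valid c.δ₀) (hs : SignsL c α₂ q.B₃)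
    (hsmall : c.ε₁ * remCoeffL 4 M c α₂ q.B₃ ≤ B12Normalization.stepBal Nc Lc)
    (hcont : letI := θ.instVβ₁; letI := θ.instVβ₂; letI := θ.instιβ
      ∀ k (z : Pt 4), ContinuousOn (fun p : Fin (k + 1) → ℝ =>
        polLimit F (k + 1) (fun K => mergedTermFamilyMatT F N (TcOfRecord F N) (chiFixed7 F N θ.ν) θ.εbg k p K) θ.ρ8 θ.bV 0 1 z)
        (Box γ₀ k)) :
    EndpointExistence (datumOfRecord₁₁ F N θ hP).C.toB12 ∧
      ∃ γc : ℝ, 0 < γc ∧ BetaContH γc (datumOfRecord₁₁ F N θ hP).βfun := by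
  letI := θ.instVβ₁; letI := θ.instVβ₂; letI := θ.instιβ
  have hres : AtSlopeCont
      (oneLoopSplit_betaOfMerged (betaMerged F (mergedTermFamilyMatT F N (TcOfRecord F N) (chiFixed7 F N θ.ν) θ.εbg) θ.ρ8 θ.bV)
        (beta0OfMerged (betaMerged F (mergedTermFamilyMatT F N (TcOfRecord F N) (chiFixed7 F N θ.ν) θ.εbg) θ.ρ8 θ.bV) θ.v₀) θ.γ)
      γ₀ (B12Normalization.stepBal Nc Lc) :=
    atSlopeCont_betaOfMerged F _ θ.ρ8 θ.bV _ hle P0 hβ0 hP0 A1 hrep hleaves hC h22 hq hs hsmall hcont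
  refine ⟨?_, γ₀, hγ₀, ?_⟩
  · exact endpointExistence_of_residue_atSlopeCont (datumOfRecord₁₁ F N θ hP).fwd
      (oneLoopSplit_betaOfMerged _ _ _) Js (fun j => hβ j) h1 hγ₀ hres
  · exact betaContH_of_atSlopeCont hres

/-- **N25's END ∧ N26 AT A STAGE-11 RECORD `(D, w)`, predicate form, ONE PIN** (dag-ref-D N-n26-4): the (D1) road run in the β-layer's own channel
`(0, 1)` with the one-loop kernels TAKEN TO BE the typed step kernels, `P0 k := T̄_k(·)₀₁ = TbalOf Lc Js k 0 1` — so (D1)'s pin IS the socket's `hβ0`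
(one hypothesis, no consistency condition), (5.10) is asked of `TbalOf Lc Js k 0 1`, and `hrep` reads «merged limit kernel = one-shot step kernel + leaf
sum»; the package is asked of EVERY admissible θ with provisos realising `D`, on the world's window `]0, w.γ]`.  Instance 0∕1 (rows (D1), (D4)); N25 ∕
N26 NOT discharged. [cite: Balaban1987RG1, Thm 2 p.259 (first sentence), (1.20)-(1.22) p.264 and (2.12)-(2.13) p.268; Balaban1988RG2Cluster, Lemma 3 (2.38) p.20] -/
theorem endpoint_and_n26_of_isRecordOfRecord₁₁C {D : FiniteEpsData F (Matrix.specialUnitaryGroup (Fin N) ℂ)} {w : WorldP}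
    (h : IsRecordOfRecord₁₁C F N D w)
    (hin : ∀ (θ : Stage11Params F N) (hP : θ.Provisos₁₁), θ.Admissible → D = datumOfRecord₁₁ F N θ hP → w.γ ≤ θ.γ →
      letI := θ.instVβ₁; letI := θ.instVβ₂; letI := θ.instιβ
      ∃ (Lc : ℕ) (_ : NeZero Lc) (Js : ℕ → JetData 3 Lc) (Nc : ℝ) (M : ℕ) (_ : NeZero M) (c : B13.Consts) (ℓ α₂ : ℝ)
        (q : Consts190) (A1 : (k : ℕ) → (Fin (k + 1) → ℝ) → LDom 4 → Pt 4 → ℝ),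
        (∀ j, beta0OfMerged (betaMerged F (mergedTermFamilyMatT F N (TcOfRecord F N) (chiFixed7 F N θ.ν) θ.εbg) θ.ρ8 θ.bV) θ.v₀ j =
          B12Beta.secondMoment (TbalOf Lc Js j) 0 1) ∧
        D1Residue.Residue Lc Js Nc 0 1 ∧
        (∀ k, ∃ C δ₁ : ℝ, 0 < δ₁ ∧ B12Sec2to5.Decay510 (TbalOf Lc Js k 0 1) C δ₁) ∧
        (∀ k (p : Fin (k + 1) → ℝ), p ∈ Box w.γ k → ∀ z : Pt 4,
          polLimit F (k + 1) (fun K => mergedTermFamilyMatT F N (TcOfRecord F N) (chiFixed7 F N θ.ν) θ.εbg k p K) θ.ρ8 θ.bV 0 1 z =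
            TbalOf Lc Js k 0 1 z + limKernel (A1 k p) z) ∧
        (∀ k (p : Fin (k + 1) → ℝ), p ∈ Box w.γ k → Nonempty (PolLeavesTFac190H 4 M (A1 k p) c ℓ α₂ q)) ∧
        CondsL 4 c ℓ ∧ c.R22gen ℓ ∧ q.Valid c.δ₀ ∧ SignsL c α₂ q.B₃ ∧
        c.ε₁ * remCoeffL 4 M c α₂ q.B₃ ≤ B12Normalization.stepBal Nc Lc ∧
        (∀ k (z : Pt 4), ContinuousOn (fun p : Fin (k + 1) → ℝ =>
          polLimit F (k + 1) (fun K => mergedTermFamilyMatT F N (TcOfRecord F N) (chiFixed7 F N θ.ν) θ.εbg k p K) θ.ρ8 θ.bV 0 1 z)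
          (Box w.γ k))) :
    EndpointExistence D.C.toB12 ∧ ∃ γc : ℝ, 0 < γc ∧ BetaContH γc D.βfun := by
  obtain ⟨θ, hP, hθ, hD, -, ⟨hγ0, hγle⟩, -, -⟩ := h
  obtain ⟨Lc, _, Js, Nc, M, _, c, ℓ, α₂, q, A1, hβ, h1, hP0, hrep, hleaves, hC, h22, hq, hs, hsmall, hcont⟩ :=
    hin θ hP hθ hD hγle
  subst hD
  letI := θ.instVβ₁; letI := θ.instVβ₂; letI := θ.instιβ
  -- the ONE pin, re-read as the socket's `hβ0` with `P0 k := TbalOf Lc Js k 0 1` (unfold (1.22) once; no deep unfolding of the step kernels)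
  have hβ0 : ∀ k, beta0OfMerged (betaMerged F (mergedTermFamilyMatT F N (TcOfRecord F N) (chiFixed7 F N θ.ν) θ.εbg) θ.ρ8 θ.bV) θ.v₀ k =
      B12Beta.secondMoment (fun _ _ => TbalOf Lc Js k 0 1) 0 1 := fun k => by
    rw [hβ k]; unfold B12Beta.secondMoment; rfl
  exact endpoint_and_n26_datumOfRecord₁₁ F N θ hP Js hβ h1 hγ0 hγle (fun k => TbalOf Lc Js k 0 1) hβ0 hP0 A1 hrep
    (fun k p hp => Classical.choice (hleaves k p hp)) hC h22 hq hs hsmall hcont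

variable {F N}

/-- **«N26 CLOSES WITH N25» AT THE STAGE-11 RECORD PREDICATE**: the route literals `YMDAG.UVSplit.S_N25 Rec` (END at every record) AND
`YMDAG.UVSplit.N26_B4lit Rec` at `Rec := IsRecordOfRecord₁₁C`, BOTH from ONE (D1)-residue + (D4)-socket package asked of every admissible θ with provisos
(`endpoint_and_n26_of_isRecordOfRecord₁₁C`) — the β-side shape of route crux K2 `EndpointGivenBR11` (over `IsRecordOfRecord₁₁C F 2`, with (B) and the
window as further, here unused, hypotheses).  ∀-forms, NOT-A-DISCHARGE (INHABITED-AT-₁₁C guard); N25 ∕ N26 NOT discharged.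
[cite: Balaban1987RG1, Thm 2 p.259 (first sentence) and (1.20)-(1.22) p.264; Balaban1988RG2Cluster, Lemma 3 (2.38) p.20] -/
theorem s_N25_and_n26_B4lit_rec11C
    (hin : ∀ (F : T4Family) (D : FiniteEpsData F (Matrix.specialUnitaryGroup (Fin N) ℂ)) (w : WorldP)
      (θ : Stage11Params F N) (hP : θ.Provisos₁₁), θ.Admissible → D = datumOfRecord₁₁ F N θ hP → w.γ ≤ θ.γ →
      letI := θ.instVβ₁; letI := θ.instVβ₂; letI := θ.instιβ
      ∃ (Lc : ℕ) (_ : NeZero Lc) (Js : ℕ → JetData 3 Lc) (Nc : ℝ) (M : ℕ) (_ : NeZero M) (c : B13.Consts) (ℓ α₂ : ℝ)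
        (q : Consts190) (A1 : (k : ℕ) → (Fin (k + 1) → ℝ) → LDom 4 → Pt 4 → ℝ),
        (∀ j, beta0OfMerged (betaMerged F (mergedTermFamilyMatT F N (TcOfRecord F N) (chiFixed7 F N θ.ν) θ.εbg) θ.ρ8 θ.bV) θ.v₀ j =
          B12Beta.secondMoment (TbalOf Lc Js j) 0 1) ∧
        D1Residue.Residue Lc Js Nc 0 1 ∧
        (∀ k, ∃ C δ₁ : ℝ, 0 < δ₁ ∧ B12Sec2to5.Decay510 (TbalOf Lc Js k 0 1) C δ₁) ∧
        (∀ k (p : Fin (k + 1) → ℝ), p ∈ Box w.γ k → ∀ z : Pt 4,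
          polLimit F (k + 1) (fun K => mergedTermFamilyMatT F N (TcOfRecord F N) (chiFixed7 F N θ.ν) θ.εbg k p K) θ.ρ8 θ.bV 0 1 z =
            TbalOf Lc Js k 0 1 z + limKernel (A1 k p) z) ∧
        (∀ k (p : Fin (k + 1) → ℝ), p ∈ Box w.γ k → Nonempty (PolLeavesTFac190H 4 M (A1 k p) c ℓ α₂ q)) ∧
        CondsL 4 c ℓ ∧ c.R22gen ℓ ∧ q.Valid c.δ₀ ∧ SignsL c α₂ q.B₃ ∧
        c.ε₁ * remCoeffL 4 M c α₂ q.B₃ ≤ B12Normalization.stepBal Nc Lc ∧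
        (∀ k (z : Pt 4), ContinuousOn (fun p : Fin (k + 1) → ℝ =>
          polLimit F (k + 1) (fun K => mergedTermFamilyMatT F N (TcOfRecord F N) (chiFixed7 F N θ.ν) θ.εbg k p K) θ.ρ8 θ.bV 0 1 z)
          (Box w.γ k))) :
    YMDAG.UVSplit.S_N25 (fun F D w => IsRecordOfRecord₁₁C F N D w) ∧
      YMDAG.UVSplit.N26_B4lit (fun F D w => IsRecordOfRecord₁₁C F N D w) :=
  ⟨fun F D w h => (endpoint_and_n26_of_isRecordOfRecord₁₁C F N h (hin F D w)).1,
    fun F D w h => (endpoint_and_n26_of_isRecordOfRecord₁₁C F N h (hin F D w)).2⟩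

end WithN25

end Summit.QuantumFields.YangMills.Theorems.BalabanUVNodesN26AtRecord11

end
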